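import Summits.Ventures.LatticeQCDFlow.Exactness.Phi4MetropolisMagnetisationCSD
import HarnessLib

/-!
# The CSD floor with the SECOND MOMENT of the step law: `τ_int,sweep(M) ≥ 2χ/m₂ − ½`, `m₂ = ∫ u² ρ(u) du` (`= δ²/3` for the window)

HONEST FRAMING: exact (Metropolis-corrected) sampling algorithms for lattice gauge theory;
figures of merit are autocorrelation/cost numbers at stated couplings and volumes; no
continuum-physics claim.  (SCALAR calibration rung S0-A: not a gauge result.)

Venture `LatticeQCDFlow` (cell pub-lqcd), topic `Exactness`; FANOUT row 2 (`s0-phi4`, LOCAL arm).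
NEW WORK of the cell, a sharpening of `Phi4MetropolisCSDFloor` / `Phi4MetropolisMagnetisationCSD`:
there the carré du champ of a coordinate-Lipschitz observable is bounded by the squared window
half-width `δ²`; but a proposal `u ∼ ρ` moves such an observable by at most `|u|`, so the bound is
really the SECOND MOMENT `m₂ = ∫ u² ρ(u) du` of the step law — `δ²/3` for the engine's uniform window
`U[−δ, δ]`, three times sharper, and finite for Gaussian steps.  Nothing is cited as a fact
(Madras–Slade 1993 Cor. 9.2.3 named for the per-step form).

## What is proved (`Λ = Fin (n+1)`, `λ > 0`, any `J`, `ρ ≥ 0` an even probability density with `u²ρ(u)` integrable)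

* `metroSite_sq_dev_le_moment`, **`metroScan_sq_dev_le_moment`** — for `g` 1-Lipschitz in each
  coordinate: `K[(g − g φ)²](φ) ≤ m₂` at every configuration (no window needed);
* **`metropolisScan_tauInt_sweep_ge_moment`** — bounded measurable coordinate-Lipschitz `f`,
  `g = f − ⟨f⟩`, ANY such step law: summable sweep-thinned series and `ρ_g(n+1) < 1` ⇒
  `τ_int,sweep(f) ≥ 2 Var(f)/((n+1) m₂) − ½` (clipped magnetisation:
  `metropolisScan_tauInt_sweep_ge_clipMag_moment`);
* **`metropolisScan_tauInt_sweep_ge_magnetisation_moment`** — for the magnetisation itself under a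
  window step law (`ρ = 0` off `[−δ, δ]`, where the unbounded-class machinery is available):
  `τ_int,sweep(M) ≥ 2χ/m₂ − ½` with `m₂ ≤ δ²` (`= δ²/3` for `U[−δ, δ]`: `τ_int,sweep(M) ≥ 6χ/δ² − ½`).

NOT CLAIMED: the ordered sweep; `ρ_g < 1` / summability (hypotheses); `M` itself under step laws of
unbounded support (needs moment versions of the envelope estimates); any value of `χ`.
-/

namespace Summit.Ventures.LatticeQCDFlow.Exactness

open Real MeasureTheory Filter Finset
open Summit.Ventures.LatticeQCDFlow.Scoring

section SecondMoment

variable {n : ℕ}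

/-- **One site, second moment**: if `|g(φ|φ_x:=t') − g(φ)| ≤ |t' − φ_x|` then
`M_x[(g − g φ)²](φ) ≤ ∫ u² ρ(u) du`. -/
theorem metroSite_sq_dev_le_moment (J : Fin (n + 1) → Fin (n + 1) → ℝ) (lam : ℝ) {ρ : ℝ → ℝ}
    (hρ0 : ∀ u, 0 ≤ ρ u) (hρ2 : Integrable (fun u => u ^ 2 * ρ u)) (x : Fin (n + 1))
    {g : (Fin (n + 1) → ℝ) → ℝ} (φ : Fin (n + 1) → ℝ)
    (hlip : ∀ t', |g (Function.update φ x t') - g φ| ≤ |t' - φ x|) :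
    metroSite J lam ρ x (fun ψ => (g ψ - g φ) ^ 2) φ ≤ ∫ u, u ^ 2 * ρ u := by
  have hρt : Integrable (fun t' => (t' - φ x) ^ 2 * ρ (t' - φ x)) := hρ2.comp_sub_right (φ x)
  have hρt1 : ∫ t', (t' - φ x) ^ 2 * ρ (t' - φ x) = ∫ u, u ^ 2 * ρ u :=
    integral_sub_right_eq_self (μ := (volume : Measure ℝ)) (fun u => u ^ 2 * ρ u) (φ x)
  unfold metroSite
  simp only [sub_self, zero_pow (two_ne_zero), mul_zero, add_zero]
  rw [← hρt1]
  refine integral_mono_of_nonneg (Eventually.of_forall fun t' => ?_) hρt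
    (Eventually.of_forall fun t' => ?_)
  · obtain ⟨ha0, -⟩ := metroAccept_nonneg_le J lam x φ t'
    exact mul_nonneg (mul_nonneg ha0 (sq_nonneg _)) (hρ0 _)
  · obtain ⟨ha0, ha1⟩ := metroAccept_nonneg_le J lam x φ t'
    have hsq : (g (Function.update φ x t') - g φ) ^ 2 ≤ (t' - φ x) ^ 2 := by
      rw [← sq_abs, ← sq_abs (t' - φ x)]
      exact pow_le_pow_left₀ (abs_nonneg _) (hlip t') 2
    calc metroAccept J lam x φ t' * (g (Function.update φ x t') - g φ) ^ 2 * ρ (t' - φ x)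
        ≤ 1 * (t' - φ x) ^ 2 * ρ (t' - φ x) := by
          gcongr
          exact hρ0 _
      _ = (t' - φ x) ^ 2 * ρ (t' - φ x) := by ring

/-- **The scan, second moment**: `K[(g − g φ)²](φ) ≤ m₂ = ∫ u² ρ(u) du` for `g` 1-Lipschitz in
each coordinate. -/
theorem metroScan_sq_dev_le_moment (J : Fin (n + 1) → Fin (n + 1) → ℝ) (lam : ℝ) {ρ : ℝ → ℝ}
    (hρ0 : ∀ u, 0 ≤ ρ u) (hρ2 : Integrable (fun u => u ^ 2 * ρ u))
    {g : (Fin (n + 1) → ℝ) → ℝ} (φ : Fin (n + 1) → ℝ)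
    (hlip : ∀ x t', |g (Function.update φ x t') - g φ| ≤ |t' - φ x|) :
    metroScan J lam ρ (fun ψ => (g ψ - g φ) ^ 2) φ ≤ ∫ u, u ^ 2 * ρ u := by
  have hn : (0 : ℝ) < (n : ℝ) + 1 := by positivity
  unfold metroScan
  rw [div_le_iff₀ hn]
  calc ∑ x, metroSite J lam ρ x (fun ψ => (g ψ - g φ) ^ 2) φ ≤ ∑ _x : Fin (n + 1), ∫ u, u ^ 2 * ρ u :=
        Finset.sum_le_sum fun x _ => metroSite_sq_dev_le_moment J lam hρ0 hρ2 x φ (hlip x)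
    _ = (∫ u, u ^ 2 * ρ u) * ((n : ℝ) + 1) := by
        rw [Finset.sum_const, Finset.card_univ, Fintype.card_fin, nsmul_eq_mul]
        push_cast
        ring

/-- **CSD FLOOR WITH THE SECOND MOMENT, bounded coordinate-Lipschitz observables, ANY even step
density with finite second moment.**  `λ > 0`, any `J`; `f` bounded measurable with
`|f(φ|φ_x:=t') − f(φ)| ≤ |t' − φ_x|`, `g = f − ⟨f⟩`, `K` the random-site scan, one sweep = `n+1`
updates, `m₂ = ∫ u² ρ(u) du`.  Summable sweep-thinned series and `ρ_g(n+1) < 1` ⇒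
`τ_int,sweep(f) ≥ 2 ⟨(f − ⟨f⟩)²⟩/((n+1) m₂) − ½`. -/
theorem metropolisScan_tauInt_sweep_ge_moment {lam : ℝ} (hlam : 0 < lam)
    (J : Fin (n + 1) → Fin (n + 1) → ℝ) {ρ : ℝ → ℝ} (hρ0 : ∀ u, 0 ≤ ρ u) (hρm : Measurable ρ)
    (hρi : Integrable ρ) (hρ1 : ∫ u, ρ u = 1) (hρs : ∀ u, ρ (-u) = ρ u)
    (hρ2 : Integrable (fun u => u ^ 2 * ρ u)) {f : (Fin (n + 1) → ℝ) → ℝ} (hf : BddObs f)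
    (hlip : ∀ (φ : Fin (n + 1) → ℝ) (x : Fin (n + 1)) (t' : ℝ),
      |f (Function.update φ x t') - f φ| ≤ |t' - φ x|)
    (hs : Summable fun k => (∫ φ, (f φ - gibbsExpect J lam f)
        * ((metroScan J lam ρ)^[(n + 1) * (k + 1)] (fun ψ => f ψ - gibbsExpect J lam f)) φ
        * gibbsWeight J lam φ) / ∫ φ, (f φ - gibbsExpect J lam f) ^ 2 * gibbsWeight J lam φ)
    (hρV : (∫ φ, (f φ - gibbsExpect J lam f)
        * ((metroScan J lam ρ)^[n + 1] (fun ψ => f ψ - gibbsExpect J lam f)) φ * gibbsWeight J lam φ)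
        / (∫ φ, (f φ - gibbsExpect J lam f) ^ 2 * gibbsWeight J lam φ) < 1) :
    2 * gibbsExpect J lam (fun φ => (f φ - gibbsExpect J lam f) ^ 2) / ((n + 1) * ∫ u, u ^ 2 * ρ u)
        - 1 / 2
      ≤ tauInt (fun k => (∫ φ, (f φ - gibbsExpect J lam f)
          * ((metroScan J lam ρ)^[(n + 1) * k] (fun ψ => f ψ - gibbsExpect J lam f)) φ
          * gibbsWeight J lam φ) / ∫ φ, (f φ - gibbsExpect J lam f) ^ 2 * gibbsWeight J lam φ) := by
  have hco := latticePhi4Action_coercive hlam J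
  obtain ⟨hfm, B, hfb⟩ := hf
  obtain ⟨hgm, hgb, -⟩ := centred_observable hlam J hfm hfb
  have hg : BddObs (fun ψ => f ψ - gibbsExpect J lam f) := ⟨hgm, _, hgb⟩
  have hglip : ∀ (φ : Fin (n + 1) → ℝ) (x : Fin (n + 1)) (t' : ℝ),
      |(f (Function.update φ x t') - gibbsExpect J lam f) - (f φ - gibbsExpect J lam f)|
        ≤ |t' - φ x| := by
    intro φ x t'
    rw [show (f (Function.update φ x t') - gibbsExpect J lam f) - (f φ - gibbsExpect J lam f)
      = f (Function.update φ x t') - f φ by ring]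
    exact hlip φ x t'
  have hΓ : ∀ φ, metroScan J lam ρ (fun ψ => ((f ψ - gibbsExpect J lam f)
      - (f φ - gibbsExpect J lam f)) ^ 2) φ ≤ ∫ u, u ^ 2 * ρ u := fun φ =>
    metroScan_sq_dev_le_moment J lam hρ0 hρ2 φ (hglip φ)
  have hfloor := RevOp.thinned_tauInt_ge_of_carre_le (μ := volume) (A := BddObs)
    (K := metroScan J lam ρ) (w := gibbsWeight J lam)
    (fun φ => (gibbsWeight_pos J lam φ).le) (bddObs_const 1)
    (fun f h hf hh => bddObs_integrable_mul_mul_gibbsWeight one_pos hco hf hh)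
    (fun f h c hf hh => bddObs_add_mul hf hh c)
    (fun f hf => bddObs_metroScan J lam hρ0 hρm hρi hρ1 hf)
    (fun f h c hf hh x => metroScan_add_mul J lam hρ0 hρm hρi hf hh c x)
    (fun f h hf hh => metroScan_reversible one_pos hco hρ0 hρm hρi hρ1 hρs hf hh)
    (fun f hf => metroScan_contraction one_pos hco hρ0 hρm hρi hρ1 hρs hf)
    (fun φ => metroScan_one J lam hρ1 φ) hg (bddObs_sq hg) hΓ (show 0 < n + 1 by omega) hs hρV
  have e : ∀ P Z D : ℝ, 2 * (P / Z) / (((n : ℝ) + 1) * D) - 1 / 2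
      = 2 * P / (((n + 1 : ℕ) : ℝ) * D * Z) - 1 / 2 := by
    intro P Z D
    push_cast
    rw [← mul_div_assoc, div_div, mul_comm Z]
  exact (e _ _ _).le.trans hfloor

/-- **The clipped magnetisation, second-moment form**: every clip level `N`, every even step density
with finite second moment: `τ_int,sweep(clip_N M) ≥ 2 Var(clip_N M)/((n+1) m₂) − ½`. -/
theorem metropolisScan_tauInt_sweep_ge_clipMag_moment {lam : ℝ} (hlam : 0 < lam)
    (J : Fin (n + 1) → Fin (n + 1) → ℝ) {ρ : ℝ → ℝ} (hρ0 : ∀ u, 0 ≤ ρ u) (hρm : Measurable ρ)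
    (hρi : Integrable ρ) (hρ1 : ∫ u, ρ u = 1) (hρs : ∀ u, ρ (-u) = ρ u)
    (hρ2 : Integrable (fun u => u ^ 2 * ρ u)) (N : ℝ)
    (hs : Summable fun k => (∫ φ, (max (-N) (min N (∑ y, φ y))
          - gibbsExpect J lam (fun ψ => max (-N) (min N (∑ y, ψ y))))
        * ((metroScan J lam ρ)^[(n + 1) * (k + 1)] (fun ψ => max (-N) (min N (∑ y, ψ y))
          - gibbsExpect J lam (fun ψ => max (-N) (min N (∑ y, ψ y))))) φ * gibbsWeight J lam φ)
        / ∫ φ, (max (-N) (min N (∑ y, φ y))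
          - gibbsExpect J lam (fun ψ => max (-N) (min N (∑ y, ψ y)))) ^ 2 * gibbsWeight J lam φ)
    (hρV : (∫ φ, (max (-N) (min N (∑ y, φ y))
          - gibbsExpect J lam (fun ψ => max (-N) (min N (∑ y, ψ y))))
        * ((metroScan J lam ρ)^[n + 1] (fun ψ => max (-N) (min N (∑ y, ψ y))
          - gibbsExpect J lam (fun ψ => max (-N) (min N (∑ y, ψ y))))) φ * gibbsWeight J lam φ)
        / (∫ φ, (max (-N) (min N (∑ y, φ y))
          - gibbsExpect J lam (fun ψ => max (-N) (min N (∑ y, ψ y)))) ^ 2 * gibbsWeight J lam φ)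
        < 1) :
    2 * gibbsExpect J lam (fun φ => (max (-N) (min N (∑ y, φ y))
          - gibbsExpect J lam (fun ψ => max (-N) (min N (∑ y, ψ y)))) ^ 2)
        / ((n + 1) * ∫ u, u ^ 2 * ρ u) - 1 / 2
      ≤ tauInt (fun k => (∫ φ, (max (-N) (min N (∑ y, φ y))
          - gibbsExpect J lam (fun ψ => max (-N) (min N (∑ y, ψ y))))
        * ((metroScan J lam ρ)^[(n + 1) * k] (fun ψ => max (-N) (min N (∑ y, ψ y))
          - gibbsExpect J lam (fun ψ => max (-N) (min N (∑ y, ψ y))))) φ * gibbsWeight J lam φ)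
        / ∫ φ, (max (-N) (min N (∑ y, φ y))
          - gibbsExpect J lam (fun ψ => max (-N) (min N (∑ y, ψ y)))) ^ 2 * gibbsWeight J lam φ) :=
  metropolisScan_tauInt_sweep_ge_moment hlam J hρ0 hρm hρi hρ1 hρs hρ2 (clipMag_bddObs N)
    (fun φ x t' => clipMag_coordLipschitz N φ x t') hs hρV

/-- **THE MAGNETISATION ITSELF, second-moment form** (window step law, where the unbounded-class
machinery is available): `τ_int,sweep(M) ≥ 2 Var(M)/((n+1) m₂) − ½ = 2χ/m₂ − ½`, `m₂ = ∫ u² ρ`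
(`= δ²/3` for `U[−δ, δ]`, i.e. `τ_int,sweep(M) ≥ 6χ/δ² − ½`). -/
theorem metropolisScan_tauInt_sweep_ge_magnetisation_moment {lam : ℝ} (hlam : 0 < lam)
    (J : Fin (n + 1) → Fin (n + 1) → ℝ) {ρ : ℝ → ℝ} (hρ0 : ∀ u, 0 ≤ ρ u) (hρm : Measurable ρ)
    (hρi : Integrable ρ) (hρ1 : ∫ u, ρ u = 1) (hρs : ∀ u, ρ (-u) = ρ u) {δ : ℝ} (hδ : 0 ≤ δ)
    (hρδ : ∀ u, δ < |u| → ρ u = 0) (hρ2 : Integrable (fun u => u ^ 2 * ρ u))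
    (hs : Summable fun k => (∫ φ, ((∑ y, φ y) - gibbsExpect J lam (fun ψ => ∑ y, ψ y))
        * ((metroScan J lam ρ)^[(n + 1) * (k + 1)]
            (fun ψ => (∑ y, ψ y) - gibbsExpect J lam (fun ψ => ∑ y, ψ y))) φ * gibbsWeight J lam φ)
        / ∫ φ, ((∑ y, φ y) - gibbsExpect J lam (fun ψ => ∑ y, ψ y)) ^ 2 * gibbsWeight J lam φ)
    (hρV : (∫ φ, ((∑ y, φ y) - gibbsExpect J lam (fun ψ => ∑ y, ψ y))
        * ((metroScan J lam ρ)^[n + 1]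
            (fun ψ => (∑ y, ψ y) - gibbsExpect J lam (fun ψ => ∑ y, ψ y))) φ * gibbsWeight J lam φ)
        / (∫ φ, ((∑ y, φ y) - gibbsExpect J lam (fun ψ => ∑ y, ψ y)) ^ 2 * gibbsWeight J lam φ)
        < 1) :
    2 * gibbsExpect J lam (fun φ => ((∑ y, φ y) - gibbsExpect J lam (fun ψ => ∑ y, ψ y)) ^ 2)
        / ((n + 1) * ∫ u, u ^ 2 * ρ u) - 1 / 2
      ≤ tauInt (fun k => (∫ φ, ((∑ y, φ y) - gibbsExpect J lam (fun ψ => ∑ y, ψ y))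
        * ((metroScan J lam ρ)^[(n + 1) * k]
            (fun ψ => (∑ y, ψ y) - gibbsExpect J lam (fun ψ => ∑ y, ψ y))) φ * gibbsWeight J lam φ)
        / ∫ φ, ((∑ y, φ y) - gibbsExpect J lam (fun ψ => ∑ y, ψ y)) ^ 2 * gibbsWeight J lam φ) := by
  have hco := latticePhi4Action_coercive hlam J
  set c := gibbsExpect J lam (fun ψ : Fin (n + 1) → ℝ => ∑ y, ψ y) with hc
  have hgm : Measurable (fun ψ : Fin (n + 1) → ℝ => (∑ y, ψ y) - c) :=
    (Finset.measurable_sum _ fun y _ => measurable_pi_apply y).sub measurable_const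
  have hglin : ∀ φ : Fin (n + 1) → ℝ, |(∑ y, φ y) - c| ≤ (1 + |c|) * (1 + ∑ w, |φ w|) :=
    fun φ => magnetisation_linear_growth c φ
  have hg : QuadObs (fun ψ : Fin (n + 1) → ℝ => (∑ y, ψ y) - c) := quadObs_of_linear_growth hgm hglin
  have hg2 : QuadObs (fun ψ : Fin (n + 1) → ℝ => ((∑ y, ψ y) - c) ^ 2) :=
    quadObs_sq_of_linear_growth hgm hglin
  have hglip : ∀ (φ : Fin (n + 1) → ℝ) (x : Fin (n + 1)) (t' : ℝ),
      |((∑ y, Function.update φ x t' y) - c) - ((∑ y, φ y) - c)| ≤ |t' - φ x| := by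
    intro φ x t'
    rw [show ((∑ y, Function.update φ x t' y) - c) - ((∑ y, φ y) - c) = t' - φ x by
      rw [← sum_update_sub_sum φ x t']; ring]
  have hΓ : ∀ φ, metroScan J lam ρ (fun ψ => (((∑ y, ψ y) - c) - ((∑ y, φ y) - c)) ^ 2) φ
      ≤ ∫ u, u ^ 2 * ρ u := fun φ => metroScan_sq_dev_le_moment J lam hρ0 hρ2 φ (hglip φ)
  have hfloor := RevOp.thinned_tauInt_ge_of_carre_le (μ := volume) (A := QuadObs)
    (K := metroScan J lam ρ) (w := gibbsWeight J lam)
    (fun φ => (gibbsWeight_pos J lam φ).le) (quadObs_const 1)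
    (fun f h hf hh => quadObs_integrable_mul_mul_gibbsWeight one_pos hco hf hh)
    (fun f h c hf hh => quadObs_add_mul hf hh c)
    (fun f hf => quadObs_metroScan J lam hρ0 hρm hρi hρ1 hδ hρδ hf)
    (fun f h c hf hh x => metroScan_add_mul_quad J lam hρ0 hρm hρi hδ hρδ hf hh c x)
    (fun f h hf hh => metroScan_reversible_quad one_pos hco hρ0 hρm hρi hρ1 hρs hδ hρδ hf hh)
    (fun f hf => metroScan_contraction_quad one_pos hco hρ0 hρm hρi hρ1 hρs hδ hρδ hf)
    (fun φ => metroScan_one J lam hρ1 φ) hg hg2 hΓ (show 0 < n + 1 by omega) hs hρV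
  have e : ∀ P Z D : ℝ, 2 * (P / Z) / (((n : ℝ) + 1) * D) - 1 / 2
      = 2 * P / (((n + 1 : ℕ) : ℝ) * D * Z) - 1 / 2 := by
    intro P Z D
    push_cast
    rw [← mul_div_assoc, div_div, mul_comm Z]
  exact (e _ _ _).le.trans hfloor

end SecondMoment

end Summit.Ventures.LatticeQCDFlow.Exactness
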